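import Summits.ResolutionOfSingularities.ResolutionOfSingularities.Theorems.EquisingularLiftEquisingularLiftNatP1VBPackage
import HarnessLib

/-!
# [OURS · L1 W4.5(b) · EL♮(3)] RESIDUE-1 brick R3 — T-P1VB's lift theorem for a PULLED-BACK vector bundle `F := φ̃^* F₀` on `ℙ¹_A`
# (rational multisections: the conormal datum pulled back along the lifted finite map `φ̃ : ℙ¹_O → ℙ¹_O`)

Crux chain w45b (cell `res-hironaka`, slot W4.5(b)), child crux **EL♮(3)** = stmt-ResolutionOfSingularities-20148, route EquisingularLift; research
residue `stub_elnat_three_isolated_nonConeTower` (CHILD v23/v24), res-type-027 g15's RESIDUE-1 census `L/res-type-027/RESIDUE1-CENSUS.md`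
faf4aafedf11a66b, brick **R3** (desk DEAL 2026-08-28T01:27:44Z → res-L1-w45b-stub-4 g9). HONEST FRAMING: OURS; NOT a statement of any manuscript;
AI-written, weaker than expert review. No `sorry`; standard axioms; DEF-FREE. `--supports stmt-ResolutionOfSingularities-20148 --as helper`.

WHAT. `exists_subLineBundle_lift_pullback_projectiveLine` = res-type-027's T-P1VB part 13 `P1VB.exists_subLineBundle_lift_projectiveLine` (p538935) with the
vector bundle `F` on `ℙ¹_A` replaced by a pull-back `(Scheme.Modules.pullback φ̃).obj F₀` of a vector bundle `F₀` along ANY endomorphism `φ̃ : ℙ¹_A ⟶ ℙ¹_A`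
(in the application: the lifted finite map of a rational multisection): a sub-line-bundle `L₀ ↪ g^*φ̃^*F₀` on `ℙ¹_k` with `Ȟ¹(𝓗om(L₀, Q)) = 0` lifts to a
sub-line-bundle `𝒪(d) ↪ φ̃^*F₀` on `ℙ¹_A`. It is a COROLLARY (the pull-back of a vector bundle is a vector bundle:
`isFiniteLocallyFree_of_isVectorBundle`, `IsFiniteLocallyFree.pullback`, `IsFiniteLocallyFree.isVectorBundle`) — recorded so that the multisection rounds
of RESIDUE-1 consume it by name. The local instances `MvPolynomial.gradedAlgebra` / `ProjBaseChange.algebraBase` are those of the T-P1VB files (needed to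
spell `Proj.map (mapGraded A k (Fin 2)) …` in the statement).

References (method / index only): R. Hartshorne, *Algebraic Geometry* (1977), II.5 (pull-back of locally free sheaves), III §12.
-/

noncomputable section

-- `TopCat.Presheaf`/`Scheme.Modules` are not reducible (as in Mathlib's `AlgebraicGeometry/Modules`).
set_option backward.isDefEq.respectTransparency false

open CategoryTheory AlgebraicGeometry Limits TopologicalSpace Opposite
open Literature.AlgebraicGeometry.Modules Literature.AlgebraicGeometry.Morphisms Literature.AlgebraicGeometry
open Literature.AlgebraicGeometry.Motives

attribute [local instance] MvPolynomial.gradedAlgebra Literature.AlgebraicGeometry.Motives.ProjBaseChange.algebraBase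

set_option linter.dupNamespace false -- mandated namespace `Summit.<Summit>.<Problem>` of this single-conjunct summit

namespace Summit.ResolutionOfSingularities.ResolutionOfSingularities.Cruxes.EquisingularLiftNat.P1VB

open Literature.AlgebraicGeometry.Motives.ProjBaseChangeRing (mapGraded irrelevant_le_map)

/-- **R3 — T-P1VB's lift of a sub-line-bundle for a pulled-back vector bundle `φ̃^* F₀` on `ℙ¹_A`.** See the module docstring.
[cite: Hartshorne1977, II.5 (pull-back of locally free sheaves; method)] [OURS · L1 W4.5b · RESIDUE-1 brick R3] toward
`stub_elnat_three_isolated_nonConeTower` (stmt-ResolutionOfSingularities-20148); NOT a statement of the manuscript. -/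
theorem exists_subLineBundle_lift_pullback_projectiveLine {A k : Type} [CommRing A] [IsNoetherianRing A] [IsLocalRing A] [Field k] [Algebra A k]
    (hπ : Function.Surjective (algebraMap A k))
    (φt : ProjCech.PP A 1 ⟶ ProjCech.PP A 1) (F₀ : (ProjCech.PP A 1).Modules) (hF₀ : Motives.IsVectorBundle F₀)
    (L₀ Q : (ProjCech.PP k 1).Modules)
    (ι₀ : L₀ ⟶ (Scheme.Modules.pullback (Proj.map (mapGraded A k (Fin 2)) (irrelevant_le_map A k (Fin 2)))).obj
      ((Scheme.Modules.pullback φt).obj F₀))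
    (π : (Scheme.Modules.pullback (Proj.map (mapGraded A k (Fin 2)) (irrelevant_le_map A k (Fin 2)))).obj
      ((Scheme.Modules.pullback φt).obj F₀) ⟶ Q)
    (w : ι₀ ≫ π = 0) (hS : (ShortComplex.mk ι₀ π w).ShortExact)
    (hL₀ : ∀ x : ProjCech.PP k 1, ∃ (W : (ProjCech.PP k 1).Opens) (_ : x ∈ W),
      Nonempty (SheafOfModules.free (Fin 1) ≅ L₀.over W))
    (hsplit : ∀ x : ProjCech.PP k 1, ∃ (W : (ProjCech.PP k 1).Opens) (_ : x ∈ W)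
      (r : ((Scheme.Modules.pullback (Proj.map (mapGraded A k (Fin 2)) (irrelevant_le_map A k (Fin 2)))).obj
        ((Scheme.Modules.pullback φt).obj F₀)).over W ⟶ L₀.over W), (SheafOfModules.overFunctor _ W).map ι₀ ≫ r = 𝟙 _)
    (hQ : Subsingleton (CechMH1 (ProjCech.toSpec k 1) (sheafHom L₀ Q) (fun i : Fin 2 => ProjCech.Dplus k 1 {i}))) :
    ∃ (a b : ℕ) (σ : (monomialCocycle A a b).glued ⟶ (Scheme.Modules.pullback φt).obj F₀)
      (e : L₀ ≅ (Scheme.Modules.pullback (Proj.map (mapGraded A k (Fin 2)) (irrelevant_le_map A k (Fin 2)))).obj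
        (monomialCocycle A a b).glued),
      (Scheme.Modules.pullback (Proj.map (mapGraded A k (Fin 2)) (irrelevant_le_map A k (Fin 2)))).map σ = e.inv ≫ ι₀ ∧
      ∀ x : ProjCech.PP A 1, ∃ (W : (ProjCech.PP A 1).Opens) (_ : x ∈ W)
        (r : ((Scheme.Modules.pullback φt).obj F₀).over W ⟶ (monomialCocycle A a b).glued.over W),
        (SheafOfModules.overFunctor _ W).map σ ≫ r = 𝟙 _ :=
  exists_subLineBundle_lift_projectiveLine hπ ((Scheme.Modules.pullback φt).obj F₀)
    ((isFiniteLocallyFree_of_isVectorBundle hF₀).pullback φt).isVectorBundle L₀ Q ι₀ π w hS hL₀ hsplit hQ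

end Summit.ResolutionOfSingularities.ResolutionOfSingularities.Cruxes.EquisingularLiftNat.P1VB

end
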